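import Mathlib.Analysis.SpecialFunctions.Log.NegMulLog
import Mathlib.Analysis.SpecialFunctions.Log.Base
import HarnessLib

/-!
# Lagrange certificates for maximum entropy under linear (marginal) constraints
(Dupont et al. 2026, Lemma 1) — proved

Topic `Literature/Computability/AlgebraicComplexity`.  E. Dupont, M. Eisenberger, B. Kozlovskii,
A. Mehrabian, F. J. R. Ruiz, A. See, R. Zhou, J. Alman, V. Vassilevska Williams, M. Balog, *Improving
the matrix multiplication exponent with modern optimization and AlphaEvolve*, arXiv:2608.16884v1
(2026), §2.5 "Dealing with maximum entropies".  In the combination-loss program (their eq. (11)) the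
only non-elementary quantity is `H^max_D(ρ) = sup {H(ρ') : ρ' ∈ Δ(D), ρ' has the marginals of ρ}`;
§2.5 bounds it by a *valid certificate* `(y, λ, ε)`: `y ∈ Δ(D)` strictly positive with the marginals
of `ρ`, potentials `g(a) = λ₀ + λ_X(a_X) + λ_Y(a_Y) + λ_Z(a_Z)`, and `ε ≥ 0` with
`|log y(a) − g(a)| ≤ ε` for all `a ∈ D` (eq. (12)):

> **Lemma 1.** For any valid certificate, `H(y) ≤ H^max_D(ρ) ≤ H(y) + 2ε`.

The proof (p. 8–9) is the tangent (Gibbs) inequality `H(ρ') ≤ H(y) + ⟨∇H(y), ρ' − y⟩` plus the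
observation that `⟨g, ρ' − y⟩ = 0` because `g` is a sum of functions of single marginals and `ρ', y`
have the same marginals, whence `⟨∇H(y), ρ' − y⟩ = ⟨g − log y, ρ' − y⟩ ≤ ε‖ρ' − y‖₁ ≤ 2ε`.

This file PROVES the right-hand inequality in the abstract form actually used — for ANY `ρ' ∈ Δ(D)` and
any potential `g : D → ℝ` whose `ρ'`- and `y`-averages agree (`∑ (ρ' − y) g = 0`; for the marginal
potentials of the note this is exactly "same marginals") — with entropies in bits as in the note:

* `gibbs_entropy_le` — `H(ρ') ≤ −∑ ρ'(a) log₂ y(a)` (Gibbs' inequality, from `log x ≤ x − 1`);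
* `dupont2026_lemma1` — **`H(ρ') ≤ H(y) + 2ε`** under `|log₂ y(a) − g(a)| ≤ ε` and `∑ (ρ' − y) g = 0`.

Taking the supremum over `ρ'` gives `H^max_D(ρ) ≤ H(y) + 2ε`; the left inequality of Lemma 1 is the
definition of the supremum.  (Used by the ω-construction census, family (c): every max-entropy penalty
of a certified point of program (11) is bounded through such a certificate —
`CombinationLossProgramLevelTwo.lean`, `run/shared/lean/pub/pub-omega/pub-omega-laser/SCHEMA-c.md` §4.)
Everything is proved; no definitions beyond the entropy abbreviation; no named facts.

## References

* E. Dupont et al., arXiv:2608.16884v1 (2026), §2.5, eq. (12), Lemma 1 (pp. 8–9). [DupontEtAl2026]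
* T. M. Cover, J. A. Thomas, *Elements of Information Theory* (2nd ed., 2006), Thm. 2.6.3 (Gibbs'
  inequality) and Thm. 12.1.1 (maximum entropy under linear constraints has Gibbs form). [CoverThomas2006]
-/

noncomputable section

open scoped BigOperators
open Finset Real

namespace Literature.Computability.AlgebraicComplexity

namespace MaxEntropyCertificate

variable {ι : Type*}

/-- Shannon entropy in bits of a finitely supported weight function: `H(f) = −∑_{a ∈ D} f(a) log₂ f(a)`
(`0 log 0 = 0`). [cite: DupontEtAl2026, §2.3] -/
def Hbits (D : Finset ι) (f : ι → ℝ) : ℝ := ∑ a ∈ D, Real.negMulLog (f a) / Real.log 2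

/-- The pointwise tangent inequality behind Gibbs: `−p log p + p log y ≤ y − p` for `p ≥ 0`, `y > 0`.
[folklore] -/
private theorem negMulLog_add_mul_log_le {p y : ℝ} (hp : 0 ≤ p) (hy : 0 < y) :
    Real.negMulLog p + p * Real.log y ≤ y - p := by
  rcases hp.eq_or_lt with h | h
  · subst h
    simp [Real.negMulLog_zero, hy.le]
  · have hlog : Real.log (y / p) ≤ y / p - 1 := Real.log_le_sub_one_of_pos (div_pos hy h)
    have hmul := mul_le_mul_of_nonneg_left hlog h.le
    rw [Real.log_div hy.ne' h.ne', mul_sub, mul_sub, mul_div_cancel₀ _ h.ne', mul_one] at hmul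
    rw [Real.negMulLog]
    linarith

/-- **Gibbs' inequality** (bits): for `ρ' ∈ Δ(D)` and `y ∈ Δ(D)` strictly positive,
`H(ρ') ≤ −∑_a ρ'(a) log₂ y(a)` — the tangent inequality `H(ρ') ≤ H(y) + ⟨∇H(y), ρ' − y⟩` of the
note's proof of Lemma 1 ("The entropy function `H` is concave on `Δ(D)` …"), since
`⟨∇H(y), ρ' − y⟩ = −∑ (ρ' − y) log₂ y − log₂ e · ∑ (ρ' − y)` and the last sum vanishes.
[cite: CoverThomas2006, Thm. 2.6.3; DupontEtAl2026, §2.5 (proof of Lemma 1)] -/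
theorem gibbs_entropy_le (D : Finset ι) (ρ' y : ι → ℝ) (hρ : ∀ a ∈ D, 0 ≤ ρ' a)
    (hy : ∀ a ∈ D, 0 < y a) (hρs : ∑ a ∈ D, ρ' a = 1) (hys : ∑ a ∈ D, y a = 1) :
    Hbits D ρ' ≤ -∑ a ∈ D, ρ' a * Real.logb 2 (y a) := by
  have hlog2 : 0 < Real.log 2 := Real.log_pos one_lt_two
  -- natural-log version: ∑ negMulLog ρ' + ∑ ρ' log y ≤ ∑ y − ∑ ρ' = 0
  have hnat : ∑ a ∈ D, (Real.negMulLog (ρ' a) + ρ' a * Real.log (y a)) ≤ ∑ a ∈ D, (y a - ρ' a) :=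
    Finset.sum_le_sum fun a ha => negMulLog_add_mul_log_le (hρ a ha) (hy a ha)
  rw [Finset.sum_sub_distrib, hys, hρs, sub_self, Finset.sum_add_distrib] at hnat
  -- divide by log 2
  unfold Hbits
  have h1 : ∑ a ∈ D, Real.negMulLog (ρ' a) / Real.log 2 = (∑ a ∈ D, Real.negMulLog (ρ' a)) / Real.log 2 := by
    rw [Finset.sum_div]
  have h2 : ∑ a ∈ D, ρ' a * Real.logb 2 (y a) = (∑ a ∈ D, ρ' a * Real.log (y a)) / Real.log 2 := by
    rw [Finset.sum_div]
    refine Finset.sum_congr rfl fun a _ => ?_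
    rw [Real.logb, mul_div_assoc]
  rw [h1, h2, ← neg_div, div_le_div_iff_of_pos_right hlog2]
  linarith

/-- **Dupont et al. 2026, Lemma 1 (right-hand inequality), abstract form.**  Let `y ∈ Δ(D)` be
strictly positive and `ρ' ∈ Δ(D)`; let `g : ι → ℝ` be a potential whose averages under `ρ'` and `y`
agree, `∑_a (ρ'(a) − y(a)) g(a) = 0` (for `g(a) = λ₀ + λ_X(a_X) + λ_Y(a_Y) + λ_Z(a_Z)` this says that
`ρ'` and `y` have the same three marginals), and let `|log₂ y(a) − g(a)| ≤ ε` on `D` (eq. (12)).  Then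
`H(ρ') ≤ H(y) + 2ε`.  Hence `H^max_D(ρ) ≤ H(y) + 2ε` for every valid certificate.
[cite: DupontEtAl2026, §2.5 Lemma 1] -/
theorem dupont2026_lemma1 (D : Finset ι) (ρ' y g : ι → ℝ) (ε : ℝ) (hρ : ∀ a ∈ D, 0 ≤ ρ' a)
    (hy : ∀ a ∈ D, 0 < y a) (hρs : ∑ a ∈ D, ρ' a = 1) (hys : ∑ a ∈ D, y a = 1)
    (hg : ∑ a ∈ D, (ρ' a - y a) * g a = 0)
    (hε : ∀ a ∈ D, |Real.logb 2 (y a) - g a| ≤ ε) :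
    Hbits D ρ' ≤ Hbits D y + 2 * ε := by
  have hlog2 : 0 < Real.log 2 := Real.log_pos one_lt_two
  have hG := gibbs_entropy_le D ρ' y hρ hy hρs hys
  -- H(y) = −∑ y log₂ y
  have hHy : Hbits D y = -∑ a ∈ D, y a * Real.logb 2 (y a) := by
    unfold Hbits
    rw [← Finset.sum_neg_distrib]
    refine Finset.sum_congr rfl fun a _ => ?_
    rw [Real.negMulLog, Real.logb, neg_mul, neg_div, mul_div_assoc]
  -- −∑ ρ' log₂ y = H(y) − ∑ (ρ' − y)(log₂ y − g) − ∑ (ρ' − y) g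
  have hsplit : -∑ a ∈ D, ρ' a * Real.logb 2 (y a) =
      Hbits D y - ∑ a ∈ D, (ρ' a - y a) * (Real.logb 2 (y a) - g a) - ∑ a ∈ D, (ρ' a - y a) * g a := by
    rw [hHy]
    have : ∀ a ∈ D, ρ' a * Real.logb 2 (y a) =
        y a * Real.logb 2 (y a) + (ρ' a - y a) * (Real.logb 2 (y a) - g a) + (ρ' a - y a) * g a := by
      intro a _; ring
    rw [Finset.sum_congr rfl this, Finset.sum_add_distrib, Finset.sum_add_distrib]
    ring
  rw [hsplit, hg, sub_zero] at hG
  -- |∑ (ρ' − y)(log₂ y − g)| ≤ ε ∑ |ρ' − y| ≤ 2ε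
  have habs : |∑ a ∈ D, (ρ' a - y a) * (Real.logb 2 (y a) - g a)| ≤ 2 * ε := by
    calc |∑ a ∈ D, (ρ' a - y a) * (Real.logb 2 (y a) - g a)|
        ≤ ∑ a ∈ D, |(ρ' a - y a) * (Real.logb 2 (y a) - g a)| := Finset.abs_sum_le_sum_abs _ _
      _ = ∑ a ∈ D, |ρ' a - y a| * |Real.logb 2 (y a) - g a| := by
          refine Finset.sum_congr rfl fun a _ => abs_mul _ _
      _ ≤ ∑ a ∈ D, (ρ' a + y a) * ε := by
          refine Finset.sum_le_sum fun a ha => ?_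
          have h1 : |ρ' a - y a| ≤ ρ' a + y a := by
            rw [abs_le]; constructor <;> nlinarith [hρ a ha, (hy a ha).le]
          exact mul_le_mul h1 (hε a ha) (abs_nonneg _) (by linarith [hρ a ha, (hy a ha).le])
      _ = 2 * ε := by rw [← Finset.sum_mul, Finset.sum_add_distrib, hρs, hys]; ring
  have := neg_abs_le (∑ a ∈ D, (ρ' a - y a) * (Real.logb 2 (y a) - g a))
  linarith

/-- The marginal-potential instance used in the note: if `g(a) = λ₀ + ∑_c λ_c(π_c(a))` is a sum of
functions of finitely many "coordinates" `proj_c : ι → κ` and `ρ', y` have the same `proj_c`-marginals on `D`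
for every `c`, then `∑_a (ρ'(a) − y(a)) g(a) = 0`. [cite: DupontEtAl2026, §2.5 (proof of Lemma 1)] -/
theorem sum_sub_mul_potential_eq_zero {κ : Type*} [DecidableEq κ] {n : ℕ} (D : Finset ι)
    (ρ' y : ι → ℝ) (proj : Fin n → ι → κ) (lam0 : ℝ) (lam : Fin n → κ → ℝ)
    (hsum : ∑ a ∈ D, ρ' a = ∑ a ∈ D, y a)
    (hmarg : ∀ c v, ∑ a ∈ D.filter (fun a => proj c a = v), ρ' a = ∑ a ∈ D.filter (fun a => proj c a = v), y a) :
    ∑ a ∈ D, (ρ' a - y a) * (lam0 + ∑ c, lam c (proj c a)) = 0 := by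
  have key : ∀ c, ∑ a ∈ D, (ρ' a - y a) * lam c (proj c a) = 0 := by
    intro c
    -- group by the value v = proj c a
    rw [← Finset.sum_fiberwise_of_maps_to (g := proj c) (t := D.image (proj c)) (fun a ha => Finset.mem_image_of_mem _ ha)]
    refine Finset.sum_eq_zero fun v _ => ?_
    have : ∑ a ∈ D.filter (fun a => proj c a = v), (ρ' a - y a) * lam c (proj c a) =
        (∑ a ∈ D.filter (fun a => proj c a = v), (ρ' a - y a)) * lam c v := by
      rw [Finset.sum_mul]
      refine Finset.sum_congr rfl fun a ha => ?_
      rw [(Finset.mem_filter.1 ha).2]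
    rw [this, Finset.sum_sub_distrib, hmarg c v, sub_self, zero_mul]
  calc ∑ a ∈ D, (ρ' a - y a) * (lam0 + ∑ c, lam c (proj c a))
      = (∑ a ∈ D, (ρ' a - y a)) * lam0 + ∑ c, ∑ a ∈ D, (ρ' a - y a) * lam c (proj c a) := by
        rw [Finset.sum_comm, Finset.sum_mul, ← Finset.sum_add_distrib]
        refine Finset.sum_congr rfl fun a _ => ?_
        rw [mul_add, Finset.mul_sum]
    _ = 0 := by
        rw [Finset.sum_sub_distrib, hsum, sub_self, zero_mul, zero_add]
        exact Finset.sum_eq_zero fun c _ => key c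

end MaxEntropyCertificate

end Literature.Computability.AlgebraicComplexity
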